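import Literature.NumberTheory.Automorphic.PairLFunctionNeConjOfArchAllPairs
import Literature.NumberTheory.Automorphic.SpreadPairDatumCommonFixing
import Literature.NumberTheory.Automorphic.PairLFunctionMeromorphicContinuationEqConjLocalDataThinTranslate
import HarnessLib

/-!
# Mœglin–Waldspurger, Corollaire (ii), for ALL self-pairs, from the archimedean local theory

Topic `NumberTheory/Automorphic`; namespace `Literature.NumberTheory.Automorphic`. Proof file (theorems
only) for the named fact `MoeglinWaldspurger1989_partialPairL_of_eq_conj`
(`PairLFunctionMeromorphicContinuation`): for unitary cuspidal `π`, `σ` of `GL_n(𝔸_K)`, `n ≥ 1`, with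
`π ≅ σ̃` (rendered `π = σ̄`, `P = P'.conj`) and Satake families `α`, `β` off a finite set `S` of finite
places, `s (s - 1) L^S(s, π × σ)` continues to an ENTIRE function (Mœglin–Waldspurger (1989), Appendice,
Corollaire (ii): "`L(s, ρ × ρ̌)` a deux pôles simples en `0` et `1` et est holomorphe hors de ces points";
Jacquet–Shalika (1981), §4; Cogdell (2004), Thm. 2.1, Thm. 4.2 and §4.2 for the partial function).

This is the SELF-PAIR twin of `PairLFunctionNeConjOfArchAllPairs` (Corollaire (i)(b), `π ≇ σ̃`), for every
number field, every rank and every finite `S`, modulo ONLY the archimedean test-vector statement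
`HumphriesJo2024_archRankinSelberg_testVector` (Humphries–Jo (2024), Thm. 1.1, vendored as a named fact in
`ArchRankinSelbergTestVector`). In the (i)(b) files the hypothesis `π ≠ σ̄` is used at exactly two
points: (1) the common fixing test function of the spread pair datum (`exists_spreadPairDatum_neConj`,
via `π ⟂ σ̄`) — replaced here by `exists_spreadPairDatum_of_commonFixing` fed with
`exists_testFunction_smoothedVector_eq_pairSame` (two `K_∞`-finite cusp forms of ONE cuspidal
representation, `SpreadPairDatumCommonFixing`); (2) the vanishing of the residues of the global
Rankin–Selberg integrals at `s = 1`, `0`, which removes the factor `s (s - 1)` — simply not performed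
here: the global integral `I(s; φ, φ', Φ)` of a self-pair has its two simple poles, `s (s - 1) I(s)` is
entire (`exists_entire_eq_mul_rankinSelbergIntegral`), and the residue-free per-pair reduction
`exists_entire_eq_mul_partialPairL_of_localData_thin_translate`
(`PairLFunctionMeromorphicContinuationEqConjLocalDataThinTranslate`) concludes that `s (s - 1) L^S` is
entire-valued. Everything else — the torus of Whittaker shifts off `S`, levels supported on `S`, the
line data of the finite Whittaker models, the thin test functions at the places of `S` and the
splitting `exists_const_setIntegral_pair_thin_translate_eq` of the `S`-part into a non-zero constant
times `Ψ_∞` — is the (i)(b) assembly verbatim.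

* `exists_entire_eq_mul_partialPairL_of_archPairLFactorData_allPairs` (**main**) — for every pair
  `π = σ̄` with Satake families off a finite `S`, `s (s - 1) L^S(s, π × σ)` agrees on `re s > 1` with an
  entire function, from the archimedean `L`-factor data in the consumed form of
  `PairLFunctionNeConjLevelOneOfArch`;
* `exists_entire_eq_mul_partialPairL_of_testVector_allPairs` — the same from
  `HumphriesJo2024_archRankinSelberg_testVector (n + 1) K` (`archPairLFactorData_of_testVector`);
* `MoeglinWaldspurger1989_partialPairL_of_eq_conj_of_testVector` — the named fact in rank `n` over `K`.

Not here: the presence of the pole at `s = 1` (Arthur–Clozel (2.3), `JacquetShalika1981_partialPairL_pole_of_eq_conj`,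
proved from the same archimedean input in `PairLFunctionPolesEqConjOfHumphriesJo`), functional equation,
boundedness in vertical strips.

## References

* C. Mœglin, J.-L. Waldspurger, *Le spectre résiduel de GL(n)*, Ann. Sci. ÉNS (4) 22 (1989),
  Appendice, Corollaire (ii), p. 667 [MoeglinWaldspurger1989].
* H. Jacquet, J. A. Shalika, *On Euler products and the classification of automorphic representations
  I*, Amer. J. Math. 103 (1981), §4 [JacquetShalikaAJM1981].
* H. Jacquet, I. I. Piatetski-Shapiro, J. A. Shalika, *Rankin–Selberg convolutions*, Amer. J. Math.
  105 (1983), §2 (2.7) [JacquetPiatetskiShapiroShalika1983].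
* J. W. Cogdell, *Analytic theory of L-functions for GL_n*, in *An Introduction to the Langlands
  Program* (2004), §2.3 Thm. 2.1, §4.1–§4.2, Thm. 4.2 [CogdellAnalyticTheory2004].
* P. Humphries, Y. Jo, *Test vectors for archimedean period integrals*, Publ. Mat. 68 (2024),
  Thm. 1.1 [HumphriesJo2024].
-/

noncomputable section

open MeasureTheory Measure NumberField NumberField.mixedEmbedding IsDedekindDomain Set Filter WithZero
open Literature.NumberTheory.GaloisRepresentations (ideleGroup unitIdeles)
open Literature.NumberTheory.Automorphic.WhittakerSupport
open scoped MatrixGroups ENNReal NNReal Classical ComplexConjugate Topology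

namespace Literature.NumberTheory.Automorphic

-- the automorphic quotient carries the tree's Borel σ-algebra, not Mathlib's quotient σ-algebra
attribute [-instance] Quotient.instMeasurableSpace QuotientGroup.measurableSpace

/-! ### The main theorem: all self-pairs -/

section Main

variable {n : ℕ} {K : Type} [Field K] [NumberField K]
variable {μ' : Measure (AdelicGroupData.gl (n + 1) K).automorphicQuotient} [(AdelicGroupData.gl (n + 1) K).IsAutomorphicMeasure μ']

attribute [local instance] adelicBorel borelSpace_adelic locallyCompactSpace_adelic secondCountableTopology_gl_adelic
  glAdeleBorel borelSpace_glAdele borelSpace_ideleGroup secondCountableTopology_ideleGroup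
  glInfBorel borelSpace_glInf locallyCompactSpace_glInf secondCountableTopology_glInf

attribute [local instance] Literature.MeasureTheory.Group.hasSummableGeomSeries_of_finiteDimensional
  Literature.MeasureTheory.Group.Units.borelSpace_of_isOpenEmbedding
  Literature.MeasureTheory.Group.Units.secondCountableTopology
  Literature.MeasureTheory.Group.Units.locallyCompactSpace

attribute [local instance] borelSpace_pi_mixedUnits measurableMul_pi_mixedUnits

open ValuativeRel

variable [MeasurableSpace (AdeleRing (𝓞 K) K)] [BorelSpace (AdeleRing (𝓞 K) K)]

set_option maxHeartbeats 4000000 in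
set_option synthInstance.maxHeartbeats 200000 in
/-- **Corollaire (ii) for ALL self-pairs from the archimedean local `L`-factor data.** For `n ≥ 1`, ANY
number field `K`, cuspidal `π`, `σ` on `GL_{n+1}(𝔸_K)` (of arbitrary level) with `π = σ̄` (`π ≅ σ̃`) and
Satake families `α`, `β` off a finite set `S`: `s (s - 1) L^S(s, π × σ)` agrees on `re s > 1` with an
ENTIRE function — assuming, for every pair of irreducible unitary archimedean components with non-zero
continuous Whittaker functionals and all Haar measures, finitely many `K_∞`-finite Gårding test vectors
and non-negative continuous Schwartz `Φ_∞` with `Λ(s) Σ_i Ψ_∞(s; e_i, e'_i, Φ_{∞,i}) = 1` on `re s > 1`,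
`Λ` entire (the consumed form of Jacquet–Shalika's archimedean theory, supplied by
`archPairLFactorData_of_testVector`). Proof — the self-pair twin of
`exists_entire_eq_partialPairL_of_archPairLFactorData_allPairs`: the torus `τ` of Whittaker shifts off
`S` (`exists_whittakerShiftTorus_outside`); levels supported on `S` with `Φ_ℓ(τ_f T₁) ≠ 0`,
`Φ_ℓ'(τ_f T₁') ≠ 0` (`exists_level_supportedIn_transferMap_translate_ne_zero`); the line data of the
finite Whittaker models (`exists_finWhittaker_transferMap_eq_smul`); the archimedean data of the
hypothesis for `ℓ_∞ = Φ_ℓ(T₀)`, `ℓ'_∞`; for each datum the spread pair datum at `S` INSIDE `π = σ̄`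
(`exists_spreadPairDatum_of_commonFixing`, the common fixing test function of two `K_∞`-finite cusp forms
of `π` being `exists_testFunction_smoothedVector_eq_pairSame`) whose translated thin `S`-part is
`C_i Ψ_∞(s; e_i, e'_i, Φ_{∞,i})`, `C_i ≠ 0` (`exists_const_setIntegral_pair_thin_translate_eq`); and the
residue-free per-pair reduction `exists_entire_eq_mul_partialPairL_of_localData_thin_translate` with
coefficients `C_i⁻¹`, `S' = S` and `B = Λ` (there `s (s - 1) I(s; φ, φ', Φ)` is entire,
`exists_entire_eq_mul_rankinSelbergIntegral`; Jacquet–Shalika (1981), §4 (3); Cogdell (2004), Thm. 2.1,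
§4.2). [cite: MoeglinWaldspurger1989, Appendice, Corollaire (ii), p. 667]
[cite: JacquetPiatetskiShapiroShalika1983, §2 (2.7)] [cite: CogdellAnalyticTheory2004, §2.3 Thm. 2.1, §4.1–§4.2] -/
theorem exists_entire_eq_mul_partialPairL_of_archPairLFactorData_allPairs
    (hX : ∀ (hcpt : isCompact_glFiniteIntegralLevel (n + 1) K)
      (E : Type) [NormedAddCommGroup E] [InnerProductSpace ℂ E] [CompleteSpace E]
      (τ : ContRepresentation ℂ (AutomorphyDatum.gl (n + 1) K hcpt).arch.carrier E) (hτ : τ.IsStronglyContinuous)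
      (_ : τ.IsUnitary) (_ : τ.IsTopIrreducible)
      (ℓ : archGardingSpace hcpt τ →ₗ[ℂ] ℂ) (_ : IsArchContWhittakerFunctional hcpt τ hτ ℓ) (_ : ℓ ≠ 0)
      (E' : Type) [NormedAddCommGroup E'] [InnerProductSpace ℂ E'] [CompleteSpace E']
      (τ' : ContRepresentation ℂ (AutomorphyDatum.gl (n + 1) K hcpt).arch.carrier E') (hτ' : τ'.IsStronglyContinuous)
      (_ : τ'.IsUnitary) (_ : τ'.IsTopIrreducible)
      (ℓ' : archGardingSpace hcpt τ' →ₗ[ℂ] ℂ) (_ : IsArchContWhittakerFunctional hcpt τ' hτ' ℓ') (_ : ℓ' ≠ 0)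
      [MeasurableSpace (GL (Fin (n + 1)) (mixedSpace K))] [BorelSpace (GL (Fin (n + 1)) (mixedSpace K))]
      [MeasurableSpace ((mixedSpace K)ˣ)] [BorelSpace ((mixedSpace K)ˣ)]
      (μA : Measure (Fin (n + 1) → (mixedSpace K)ˣ)) (_ : IsHaarMeasure μA)
      (μK : Measure ↥(Kinf (n + 1) K)) (_ : IsHaarMeasure μK),
      ∃ (m : ℕ) (e : Fin m → archGardingSpace hcpt τ) (e' : Fin m → archGardingSpace hcpt τ')
        (_ : ∀ i, FiniteDimensional ℂ (Submodule.span ℂ (Set.range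
          fun κ : (AutomorphyDatum.gl (n + 1) K hcpt).arch.maximalCompact => τ (toArch hcpt (κ : GL (Fin (n + 1)) (mixedSpace K))) (e i : E))))
        (_ : ∀ i, FiniteDimensional ℂ (Submodule.span ℂ (Set.range
          fun κ : (AutomorphyDatum.gl (n + 1) K hcpt).arch.maximalCompact => τ' (toArch hcpt (κ : GL (Fin (n + 1)) (mixedSpace K))) (e' i : E'))))
        (Φinf : Fin m → (Fin (n + 1) → InfiniteAdeleRing K) → ℝ) (_ : ∀ i, Continuous (Φinf i))
        (_ : ∀ i z, 0 ≤ Φinf i z)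
        (_ : ∀ i, ∃ Ψ : SchwartzMap (Fin (n + 1) → mixedSpace K) ℂ, ∀ z : Fin (n + 1) → InfiniteAdeleRing K,
          ((Φinf i z : ℝ) : ℂ) = Ψ fun j => InfiniteAdeleRing.ringEquiv_mixedSpace K (z j))
        (Λ : ℂ → ℂ), Differentiable ℂ Λ ∧ ∀ s : ℂ, 1 < s.re →
          Λ s * ∑ i, archRankinSelbergPairIntegral hcpt τ hτ τ' hτ' ℓ ℓ' (e i) (e' i) (Φinf i) μA μK s = 1)
    (νI : Measure (ideleGroup K)) [νI.IsHaarMeasure]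
    (νA : Measure (Fin (n + 1) → ideleGroup K)) [IsHaarMeasure νA]
    (νK : Measure ↥(maximalCompactAdelic (n + 1) K)) [IsHaarMeasure νK]
    (ν₀ : Measure ↥(adelicUnipotent (n + 1) K)) [IsHaarMeasure ν₀]
    (P P' : CuspidalAutomorphicRepGL (n + 1) K μ') (he : P = P'.conj)
    {S : Set (HeightOneSpectrum (𝓞 K))} (hS : S.Finite) {α β : SatakeFamily K}
    (hα : IsSatakeFamilyOf P S α) (hβ : IsSatakeFamilyOf P' S β) :
    ∃ G : ℂ → ℂ, Differentiable ℂ G ∧ ∀ s : ℂ, 1 < s.re → G s = s * (s - 1) * partialPairL S α β s := by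
  classical
  have hcpt : isCompact_glFiniteIntegralLevel (n + 1) K := isCompact_glFiniteIntegralLevel_holds (n + 1) K
  haveI := locallyCompactSpace_ideleGroup K
  have hβc : IsSatakeFamilyOf P'.conj S (fun v => (β v).map conj) := hβ.conj
  -- the finite set of bad places, as a finset
  set Sf : Finset (HeightOneSpectrum (𝓞 K)) := hS.toFinset with hSfdef
  have hSf : ∀ v, v ∈ Sf ↔ v ∈ S := fun v => hS.mem_toFinset
  have hcoe : (↑Sf : Set (HeightOneSpectrum (𝓞 K))) = S := hS.coe_toFinset
  -- (1) the torus of Whittaker shifts off `S`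
  obtain ⟨τf, af, hτlast, hratiof, hafS, hτone, hτψ⟩ := exists_whittakerShiftTorus_outside (n + 1) K Sf
  set τA : Fin (n + 1) → ideleGroup K := fun i =>
    Units.map (MonoidHom.inr (InfiniteAdeleRing K) (FiniteAdeleRing (𝓞 K) K) :
      FiniteAdeleRing (𝓞 K) K →* AdeleRing (𝓞 K) K) (τf i) with hτA
  set a : ideleGroup K := Units.map (MonoidHom.inr (InfiniteAdeleRing K) (FiniteAdeleRing (𝓞 K) K) :
      FiniteAdeleRing (𝓞 K) K →* AdeleRing (𝓞 K) K) af with ha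
  have hratio : ∀ i j : Fin (n + 1), (i : ℕ) + 1 = j → τA i * (τA j)⁻¹ = a := fun i j hij => by
    change Units.map _ (τf i) * (Units.map _ (τf j))⁻¹ = Units.map _ af
    rw [← map_inv, ← map_mul, hratiof i j hij]
  have haS : ∀ v ∈ Sf, ((a : ideleGroup K) : AdeleRing (𝓞 K) K).2 v = 1 := fun v hv => hafS v hv
  set D : GL (Fin (n + 1)) (AdeleRing (𝓞 K) K) := glDiagonal (n + 1) (AdeleRing (𝓞 K) K) τA with hD
  have hDof : D = GLn.ofFinite (n + 1) K (glDiagonal (n + 1) (FiniteAdeleRing (𝓞 K) K) τf) :=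
    glDiagonal_unitsMap_inr_eq_ofFinite τf
  have hDmix : GLn.toMixed (n + 1) K D = 1 := by rw [hDof, GLn.toMixed_ofFinite]
  have hτS : ∀ v ∈ Sf, localComponent v D = 1 := fun v hv => hτone v (Or.inl hv)
  set Df : GL (Fin (n + 1)) (FiniteAdeleRing (𝓞 K) K) := GLn.sndHom (n + 1) K D with hDf
  have hDfS : ∀ v ∈ Sf, BigHeckeGLn.localComponent (n + 1) K v Df = 1 := fun v hv => by
    rw [hDf, BigHeckeGLn.localComponent_sndHom]; exact hτS v hv
  set Splus : Finset (HeightOneSpectrum (𝓞 K)) := Sf ∪ (finite_setOf_dvd_differentIdeal (K := K)).toFinset with hSplus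
  have hDfint : ∀ w ∉ Splus, BigHeckeGLn.localComponent (n + 1) K w Df ∈ valuedCongruenceSubgroup (Fin (n + 1)) (1 : ℤᵐ⁰) := by
    intro w hw
    have h1 : localComponent w D = 1 := hτone w (Or.inr fun h => hw (Finset.mem_union_right _
      ((finite_setOf_dvd_differentIdeal (K := K)).mem_toFinset.2 h)))
    have h2 : BigHeckeGLn.localComponent (n + 1) K w Df = localComponent w D := by
      rw [hDf, BigHeckeGLn.localComponent_sndHom]
      rfl
    rw [h2, h1]
    exact one_mem _
  have hτψS : ∀ v ∉ S, ∃ (d : Fin (n + 1) → (v.adicCompletion K)ˣ) (a : (v.adicCompletion K)ˣ),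
      localComponent v (glDiagonal (n + 1) (AdeleRing (𝓞 K) K) τA) = diagonalGL (Fin (n + 1)) (v.adicCompletion K) d ∧
      (∀ i j : Fin (n + 1), (i : ℕ) + 1 = j →
        (d i : v.adicCompletion K) * ((d j)⁻¹ : (v.adicCompletion K)ˣ) = a) ∧
      (∀ c ∈ 𝒪[v.adicCompletion K], (adeleAddChar K).adicComponent v (a * c) = 1) ∧
      ∀ ϖ : v.adicCompletion K, Valued.v ϖ = WithZero.exp (-1 : ℤ) →
        ∃ c ∈ 𝒪[v.adicCompletion K], (adeleAddChar K).adicComponent v (a * (ϖ⁻¹ * c)) ≠ 1 :=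
    fun v hv => hτψ v fun h => hv ((hSf v).1 h)
  -- (2) archimedean components, global Whittaker functionals
  obtain ⟨E, _, _, _, τ, hτi, hτu, hτc, hex, -⟩ := exists_archComponent_decomposition (hcpt := hcpt) P
  obtain ⟨E', _, _, _, τ', hτi', hτu', hτc', hex', -⟩ := exists_archComponent_decomposition (hcpt := hcpt) P'.conj
  have hℓ : IsContWhittakerFunctional P.1 (adeleAddChar K)
      (whittakerFunctional ν₀ (continuous_adeleAddChar K) (ContRepresentation.Equiv.refl P.1.toContRep)) :=
    isContWhittakerFunctional_whittakerFunctional ν₀ (continuous_adeleAddChar K) (isGlobalAddChar_adeleAddChar K) _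
  have hℓ' : IsContWhittakerFunctional P'.conj.1 (adeleAddChar K)
      (whittakerFunctional ν₀ (continuous_adeleAddChar K) (ContRepresentation.Equiv.refl P'.conj.1.toContRep)) :=
    isContWhittakerFunctional_whittakerFunctional ν₀ (continuous_adeleAddChar K) (isGlobalAddChar_adeleAddChar K) _
  -- (3) levels supported on `S` with non-vanishing transferred functionals at `D_f`
  obtain ⟨𝔫₁, h𝔫₁, hS𝔫₁, T₁, hT₁, hT₁ne⟩ := exists_level_supportedIn_transferMap_translate_ne_zero hcpt (Nat.succ_pos n) P hα
    Sf (fun v hv => (hSf v).2 hv) hτu hτi hτc hex ν₀ τA hτψS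
  obtain ⟨𝔫₁', h𝔫₁', hS𝔫₁', T₁', hT₁', hT₁'ne⟩ := exists_level_supportedIn_transferMap_translate_ne_zero hcpt (Nat.succ_pos n)
    P'.conj hβc Sf (fun v hv => (hSf v).2 hv) hτu' hτi' hτc' hex' ν₀ τA hτψS
  -- (4) the line data of the finite Whittaker models
  have hℓ0 : whittakerFunctional ν₀ (continuous_adeleAddChar K) (ContRepresentation.Equiv.refl P.1.toContRep) ≠ 0 := by
    intro h0
    apply hT₁ne
    refine LinearMap.ext fun v => ?_
    rw [transferMap_apply_apply, h0]
    rfl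
  have hℓ0' : whittakerFunctional ν₀ (continuous_adeleAddChar K) (ContRepresentation.Equiv.refl P'.conj.1.toContRep) ≠ 0 := by
    intro h0
    apply hT₁'ne
    refine LinearMap.ext fun v => ?_
    rw [transferMap_apply_apply, h0]
    rfl
  obtain ⟨T₀, Λ₀, hΛW, -, hℓinf, hΛ⟩ := exists_finWhittaker_transferMap_eq_smul P hτu hτi hτc hex hℓ hℓ0
  obtain ⟨T₀', Λ₀', hΛW', -, hℓinf', hΛ'⟩ := exists_finWhittaker_transferMap_eq_smul P'.conj hτu' hτi' hτc' hex' hℓ' hℓ0'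
  have hne₁ : Λ₀ (finComponentRep hcpt τ P.1 Df T₁) ≠ 0 := by
    intro h0
    apply hT₁ne
    rw [hΛ, h0, zero_smul]
  have hne₁' : Λ₀' (finComponentRep hcpt τ' P'.conj.1 Df T₁') ≠ 0 := by
    intro h0
    apply hT₁'ne
    rw [hΛ', h0, zero_smul]
  -- (5) the archimedean data
  have hℓi : IsArchContWhittakerFunctional hcpt τ hτc
      (transferMap (whittakerFunctional ν₀ (continuous_adeleAddChar K) (ContRepresentation.Equiv.refl P.1.toContRep)) hτc T₀) :=
    transferMap_mem_archContWhittakerFunctionals hℓ hτc _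
  have hℓj : IsArchContWhittakerFunctional hcpt τ' hτc'
      (transferMap (whittakerFunctional ν₀ (continuous_adeleAddChar K) (ContRepresentation.Equiv.refl P'.conj.1.toContRep)) hτc' T₀') :=
    transferMap_mem_archContWhittakerFunctionals hℓ' hτc' _
  obtain ⟨m, e, e', hefin, he'fin, Φinf, hΦc, hΦ0, hΦS, Λ, hΛd, hsum⟩ :=
    hX hcpt E τ hτc hτu hτi _ hℓi hℓinf E' τ' hτc' hτu' hτi' _ hℓj hℓinf'
      ((νA.restrict (unitBox (Set.univ : Set (HeightOneSpectrum (𝓞 K))))).map (archTorusOfIdele (n + 1) K))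
      (isHaarMeasure_map_archTorusOfIdele νA) (νK.map (kinfOfMaximalCompact (n + 1) K))
      (isHaarMeasure_map_kinfOfMaximalCompact νK)
  -- (6) per datum: the spread pair datum inside `π = σ̄` and its `S`-part
  have hcf : ∀ {U : Subgroup (AdelicGroupData.gl (n + 1) K).Adelic}, U ∈ (AutomorphyDatum.gl (n + 1) K hcpt).finiteLevels →
      ∀ (u : P.1.toSubmodule) (u' : P'.conj.1.toSubmodule),
        FiniteDimensional ℂ (Submodule.span ℂ (Set.range
          fun k : (AutomorphyDatum.gl (n + 1) K hcpt).arch.maximalCompact =>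
            P.1.toContRep ((AutomorphyDatum.gl (n + 1) K hcpt).ofK k) u)) →
        FiniteDimensional ℂ (Submodule.span ℂ (Set.range
          fun k : (AutomorphyDatum.gl (n + 1) K hcpt).arch.maximalCompact =>
            P'.conj.1.toContRep ((AutomorphyDatum.gl (n + 1) K hcpt).ofK k) u')) →
        (∀ g ∈ U, P.1.toContRep g u = u) → (∀ g ∈ U, P'.conj.1.toContRep g u' = u') →
        ∃ η : (AdelicGroupData.gl (n + 1) K).Adelic → ℝ, IsTestFunctionGL (n + 1) K η ∧ (∀ k ∈ U, ∀ g, η (k * g) = η g) ∧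
          smoothedVector P.1 η u = u ∧ smoothedVector P'.conj.1 η u' = u' := by
    subst he
    intro U hU u u' hfin hfin' hUu hUu'
    exact exists_testFunction_smoothedVector_eq_pairSame hcpt _ hU u u' hfin hfin' hUu hUu'
  have hdat : ∀ k : Fin m, ∃ (md : ℕ) (𝔫 : Ideal (𝓞 K)) (Tsp : multiplicityModule hcpt τ P.1)
      (η : GL (Fin (n + 1)) (AdeleRing (𝓞 K) K) → ℝ) (C : ℂ),
      𝔫 ≠ 0 ∧ (∀ v : HeightOneSpectrum (𝓞 K), v.asIdeal ∣ 𝔫 → v ∈ Sf) ∧ IsTestFunctionGL (n + 1) K η ∧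
      (∀ k' : (AdelicGroupData.gl (n + 1) K).Adelic, k' ∈ principalCongruenceLevel (n + 1) K 𝔫 →
        ∀ g : (AdelicGroupData.gl (n + 1) K).Adelic, η (k' * g) = η g) ∧
      (T₁' : E' →L[ℂ] (AdelicGroupData.gl (n + 1) K).L2 μ') ∈
        archIntertwinersLevel hcpt τ' P'.conj.1 (finitePrincipalCongruenceLevel (n + 1) K 𝔫) ∧ C ≠ 0 ∧
      ∀ {Φ : (Fin (n + 1) → InfiniteAdeleRing K) → ℝ}, Continuous Φ → ∀ s : ℂ,
        ∫ p in unitBox {v | v ∉ (↑Sf : Set (HeightOneSpectrum (𝓞 K)))} ×ˢ Set.univ, torusPairIntegrandC (n + 1) K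
            (fun g => whittakerCoeff ν₀ (unipotentTateDomain (n + 1) K) (adeleAddChar K)
              (invQuot (AdelicGroupData.gl (n + 1) K)
                (smoothedForm η ((Tsp : E →L[ℂ] (AdelicGroupData.gl (n + 1) K).L2 μ') (e k : E))))
              (glDiagonal (n + 1) (AdeleRing (𝓞 K) K) τA * g))
            (fun g => star (whittakerCoeff ν₀ (unipotentTateDomain (n + 1) K) (adeleAddChar K)
              (invQuot (AdelicGroupData.gl (n + 1) K)
                (smoothedForm η ((T₁' : E' →L[ℂ] (AdelicGroupData.gl (n + 1) K).L2 μ') (e' k : E'))))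
              (glDiagonal (n + 1) (AdeleRing (𝓞 K) K) τA * g)))
            (thinTestFun (n + 1) K Φ Sf md) s p ∂(νA.prod νK) =
          C * archRankinSelbergPairIntegral hcpt τ hτc τ' hτc'
            (transferMap (whittakerFunctional ν₀ (continuous_adeleAddChar K)
              (ContRepresentation.Equiv.refl P.1.toContRep)) hτc T₀)
            (transferMap (whittakerFunctional ν₀ (continuous_adeleAddChar K)
              (ContRepresentation.Equiv.refl P'.conj.1.toContRep)) hτc' T₀')
            (e k) (e' k) Φ
            ((νA.restrict (unitBox (Set.univ : Set (HeightOneSpectrum (𝓞 K))))).map (archTorusOfIdele (n + 1) K))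
            (νK.map (kinfOfMaximalCompact (n + 1) K)) s := by
    intro k
    obtain ⟨md, 𝔫, h𝔫, hS𝔫, Tsp, η, t, M, c₀, hη, hηK, hmd, hrad, hΛeq, hTsp, hT₁'l, hfix, hfix', hiso, hfixK, hpar, hspread⟩ :=
      exists_spreadPairDatum_of_commonFixing P P'.conj hcf hτc ν₀ hℓinf hΛ Sf h𝔫₁ hS𝔫₁ T₁ hT₁ h𝔫₁' hS𝔫₁' T₁' hT₁' Df hDfS
        Splus hDfint (e k) (e' k) (hefin k) (he'fin k)
    have hneD : Λ₀ (finComponentRep hcpt τ P.1 (GLn.sndHom (n + 1) K (glDiagonal (n + 1) (AdeleRing (𝓞 K) K) τA)) Tsp) ≠ 0 := by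
      change Λ₀ (finComponentRep hcpt τ P.1 Df Tsp) ≠ 0
      rw [hΛeq]
      exact hne₁
    obtain ⟨C, hC0, hC⟩ := exists_const_setIntegral_pair_thin_translate_eq P P'.conj hτc hτc' νA νK ν₀ hΛW hΛ hΛW' hΛ' Sf
      hratio haS hτS hDmix h𝔫 hS𝔫 Tsp T₁' hη hmd hrad hTsp hT₁'l (e k) (e' k) hfix hfix' hiso hfixK hpar hspread hneD hne₁'
    exact ⟨md, 𝔫, Tsp, η, C, h𝔫, hS𝔫, hη, hηK, hT₁'l, hC0, fun hΦ s => hC hΦ s⟩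
  choose md 𝔫d Tsp ηd C h𝔫d hS𝔫d hηd hηKd _hT₁'d hC0 hC using hdat
  -- (7) enumerations of the Satake parameters off `S`
  have hxs : ∀ v : HeightOneSpectrum (𝓞 K), ∃ xv : Fin (n + 1) → ℂ, v ∉ S → (Finset.univ : Finset (Fin (n + 1))).val.map xv = α v := by
    intro v
    by_cases hv : v ∈ S
    · exact ⟨0, fun h => (h hv).elim⟩
    · obtain ⟨xv, hxv⟩ := exists_univ_val_map_eq (hα.card_eq hv)
      exact ⟨xv, fun _ => hxv⟩
  have hys : ∀ v : HeightOneSpectrum (𝓞 K), ∃ yv : Fin (n + 1) → ℂ, v ∉ S →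
      (Finset.univ : Finset (Fin (n + 1))).val.map yv = (β v).map conj := by
    intro v
    by_cases hv : v ∈ S
    · exact ⟨0, fun h => (h hv).elim⟩
    · obtain ⟨yv, hyv⟩ := exists_univ_val_map_eq (α := (β v).map conj) (m := n + 1)
        (by rw [Multiset.card_map]; exact hβ.card_eq hv)
      exact ⟨yv, fun _ => hyv⟩
  choose xs hxs' using hxs
  choose ys hys' using hys
  -- (8) the per-pair reduction with thin `S`-parts, `S' = S`, coefficients `C_k⁻¹` and `B = Λ`
  have hS'f : ∀ _ : Fin m, ((↑Sf : Set (HeightOneSpectrum (𝓞 K))) \ S).Finite := fun _ =>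
    (Finset.finite_toSet Sf).subset sdiff_subset
  have hnotin : ∀ {v : HeightOneSpectrum (𝓞 K)}, v ∉ (↑Sf : Set (HeightOneSpectrum (𝓞 K))) ↔ v ∉ S := fun {v} => by
    rw [hcoe]
  refine exists_entire_eq_mul_partialPairL_of_localData_thin_translate νI νA νK ν₀ (Nat.succ_pos n) P P' hα hβ
    (fun k => (C k)⁻¹)
    (fun k => ⟨(Tsp k : E →L[ℂ] (AdelicGroupData.gl (n + 1) K).L2 μ') (e k : E), apply_mem_of_mem_multiplicityModule (Tsp k) (e k)⟩)
    (fun k => ⟨(T₁' : E' →L[ℂ] (AdelicGroupData.gl (n + 1) K).L2 μ') (e' k : E'), apply_mem_of_mem_multiplicityModule T₁' (e' k)⟩)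
    (𝔫₀ := 𝔫d) h𝔫d hηd hηKd (S' := fun _ => (↑Sf : Set (HeightOneSpectrum (𝓞 K)))) hS'f
    (fun _ v hv => by rw [hcoe]; exact hv) (fun k v hv h => hv (Finset.mem_coe.2 (hS𝔫d k v h)))
    (Tth := fun _ => Sf) md (fun _ => subset_rfl) τA hτlast (fun _ v hv => hτψS v (hnotin.1 hv))
    (x := fun _ v => xs v) (y := fun _ v => ys v) (fun _ v hv => hxs' v (hnotin.1 hv)) (fun _ v hv => hys' v (hnotin.1 hv))
    hΦc hΦ0 (fun k => ?_) hΛd fun s hs1 _ => ?_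
  · obtain ⟨Ψ, hΨ⟩ := hΦS k
    exact ofReal_thinTestFun_mem_piSchwartzBruhat hΨ Sf (md k)
  · -- `Λ(s) · Σ_k C_k⁻¹ · (1 · C_k Ψ_∞,k(s)) = Λ(s) Σ_k Ψ_∞,k(s) = 1`
    have htoF : ∀ k : Fin m, (hS'f k).toFinset = ∅ := fun k => by
      rw [Set.Finite.toFinset_eq_empty, Set.sdiff_eq_empty, hcoe]
    refine (congrArg (fun z : ℂ => Λ s * z) (Finset.sum_congr rfl fun k _ => ?_)).trans (hsum s hs1)
    rw [htoF k, Finset.prod_empty, one_mul]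
    erw [hC k (hΦc k) s]
    rw [← mul_assoc, inv_mul_cancel₀ (hC0 k), one_mul]

/-- **Corollaire (ii) for ALL self-pairs from the archimedean test-vector theorem.** For `n ≥ 1`, ANY
number field `K`, cuspidal `π = σ̄` on `GL_{n+1}(𝔸_K)` with Satake families off a finite `S`: granted
`HumphriesJo2024_archRankinSelberg_testVector (n + 1) K` (Humphries–Jo (2024), Thm. 1.1),
`s (s - 1) L^S(s, π × σ)` agrees on `re s > 1` with an entire function.
[cite: MoeglinWaldspurger1989, Appendice, Corollaire (ii), p. 667] [cite: HumphriesJo2024, Thm. 1.1] -/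
theorem exists_entire_eq_mul_partialPairL_of_testVector_allPairs (h : HumphriesJo2024_archRankinSelberg_testVector (n + 1) K)
    (νI : Measure (ideleGroup K)) [νI.IsHaarMeasure]
    (νA : Measure (Fin (n + 1) → ideleGroup K)) [IsHaarMeasure νA]
    (νK : Measure ↥(maximalCompactAdelic (n + 1) K)) [IsHaarMeasure νK]
    (ν₀ : Measure ↥(adelicUnipotent (n + 1) K)) [IsHaarMeasure ν₀]
    (P P' : CuspidalAutomorphicRepGL (n + 1) K μ') (he : P = P'.conj)
    {S : Set (HeightOneSpectrum (𝓞 K))} (hS : S.Finite) {α β : SatakeFamily K}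
    (hα : IsSatakeFamilyOf P S α) (hβ : IsSatakeFamilyOf P' S β) :
    ∃ G : ℂ → ℂ, Differentiable ℂ G ∧ ∀ s : ℂ, 1 < s.re → G s = s * (s - 1) * partialPairL S α β s :=
  exists_entire_eq_mul_partialPairL_of_archPairLFactorData_allPairs (archPairLFactorData_of_testVector h)
    νI νA νK ν₀ P P' he hS hα hβ

end Main

/-! ### The named fact from the archimedean test-vector theorem -/

section Fact

variable {n : ℕ} {K : Type} [Field K] [NumberField K]
variable {μ' : Measure (AdelicGroupData.gl n K).automorphicQuotient} [(AdelicGroupData.gl n K).IsAutomorphicMeasure μ']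

attribute [local instance] adelicBorel borelSpace_adelic locallyCompactSpace_adelic secondCountableTopology_gl_adelic
  glAdeleBorel borelSpace_glAdele

/-- **Mœglin–Waldspurger (1989), Appendice, Corollaire (ii), in rank `n` over `K`, for ALL self-pairs,
from the archimedean test-vector theorem** `HumphriesJo2024_archRankinSelberg_testVector n K`
(Humphries–Jo (2024), Thm. 1.1; equivalently Jacquet–Shalika's archimedean theory): the named fact
`MoeglinWaldspurger1989_partialPairL_of_eq_conj` — for cuspidal `π = σ̄` and every finite `S`,
`s (s - 1) L^S(s, π × σ)` agrees on `re s > 1` with an entire function (rank `0` is excluded by its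
hypothesis `0 < n`; the Haar measures of the reduction are chosen here). Printed: "Supposons `n = n'`,
`ρ' ≅ ρ̌`. Alors `L(s, ρ × ρ')` a deux pôles simples en `0` et `1` et est holomorphe hors de ces points";
Cogdell (2004), Thm. 4.2 with §4.2 for the partial function.
[cite: MoeglinWaldspurger1989, Appendice, Corollaire (ii), p. 667] [cite: HumphriesJo2024, Thm. 1.1]
[cite: CogdellAnalyticTheory2004, Thm. 4.2 and §4.2] -/
theorem MoeglinWaldspurger1989_partialPairL_of_eq_conj_of_testVector
    (hX2b : HumphriesJo2024_archRankinSelberg_testVector n K) :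
    MoeglinWaldspurger1989_partialPairL_of_eq_conj (n := n) (K := K) (μ := μ') := by
  cases n with
  | zero => intro hn; exact absurd hn (lt_irrefl 0)
  | succ n =>
    intro _ P P' he S hS α β hα hβ
    classical
    -- topological and measurable structures
    haveI : T2Space (GL (Fin (n + 1)) (AdeleRing (𝓞 K) K)) := t2Space_gl (n + 1) K
    haveI : LocallyCompactSpace (GL (Fin (n + 1)) (AdeleRing (𝓞 K) K)) :=
      AdelicGroupData.locallyCompactSpace_generalLinearGroup_adeleRing K (Fin (n + 1))
    haveI := secondCountableTopology_generalLinearGroup_adeleRing K (Fin (n + 1))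
    haveI : T2Space (AdeleRing (𝓞 K) K) := t2Space_adeleRing K
    letI : MeasurableSpace (AdeleRing (𝓞 K) K) := borel _
    haveI : BorelSpace (AdeleRing (𝓞 K) K) := ⟨rfl⟩
    haveI := borelSpace_ideleGroup K
    haveI := locallyCompactSpace_ideleGroup K
    haveI := secondCountableTopology_ideleGroup K
    haveI := secondCountableTopology_adeleRing K
    haveI := locallyCompactSpace_adeleRing' K
    haveI : CompactSpace ↥(maximalCompactAdelic (n + 1) K) :=
      isCompact_iff_compactSpace.1 (isCompact_maximalCompactAdelic (n + 1) K)
    haveI : LocallyCompactSpace ↥(adelicUnipotent (n + 1) K) := (isClosed_adelicUnipotent (n + 1) K).locallyCompactSpace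
    haveI : SecondCountableTopology (AdelicGroupData.gl (n + 1) K).Adelic :=
      secondCountableTopology_generalLinearGroup_adeleRing K (Fin (n + 1))
    haveI : SecondCountableTopology ↥(maximalCompactAdelic (n + 1) K) := TopologicalSpace.Subtype.secondCountableTopology _
    -- Haar measures
    obtain ⟨νI, hνI⟩ := exists_isHaarMeasure_ideleGroup K
    set νA : Measure (Fin (n + 1) → ideleGroup K) := Measure.haar with hνA
    set νK : Measure ↥(maximalCompactAdelic (n + 1) K) := Measure.haar with hνK
    set ν₀ : Measure ↥(adelicUnipotent (n + 1) K) := Measure.haar with hν₀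
    exact exists_entire_eq_mul_partialPairL_of_testVector_allPairs hX2b νI νA νK ν₀ P P' he hS hα hβ

end Fact

end Literature.NumberTheory.Automorphic
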